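import Summits.ABC.StewartYu.PadicG3TwoFunctions
import Summits.ABC.StewartYu.PadicTwoValues
import HarnessLib

/-!
# Cell abc-stewartyu, Gen-3 frame at `p = 2` (crux `Y07Two`, stmt-ABC-19659), F5 brick 1: the VALUES OF `φ_τ` AT
# THE THIRD POINTS `s/3` as signed monomials in the principal cube roots

`Summits/ABC/StewartYu/PadicG3TwoThirdValues.lean` — cell `abc-stewartyu` (HOME `run/shared/lean/pub/abc-stewartyu/`),
route `PadicPrimesKummerThird`, seat p3 (g5), F-two LEAD; first brick of the third step F5 (`ThirdStepTwo` of
p5-g3's `PadicG3TwoMain`), for the GENERIC family with SIGNED exponents on M2's `TwoSetup`.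

M2's principal cube roots `cbrt k = exp(3⁻¹·log₂ all_k)` (`PadicTwoValues`; `cbrt³ = all`, `‖cbrt − 1‖ ≤ 8⁻¹`)
give the exact exponentials at the third points: `exp(zψ(u,u_θ)·s/3) = ∏ₖ cbrt_k^{κₖ·s}` with the SIGNED exponent
vector `κ = (u, u_θ)` (`exp_third_mul_zψ`, integer powers `zpow`), hence
`φ_τ(s/3) = g3Φ τ (s/3) = ∑_{i∈B} pᵢ·(Hasse_{t₀} Rᵢ)(s/3)·∏ zγⱼ(i)^{tⱼ}·∏ₖ cbrt_k^{κᵢₖ s}` (`g3Φ_third`).  The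
sequel regroups the sum by the residues `κᵢₖ·s mod 3` (`cbrt^{3q+r} = all^q·cbrt^r`, `cbrt_zpow_eq`) into
`Multicub.ev3 cbrt (class sums)` for lit's multicubic Liouville inequality
(`MulticubLiouville.norm_ev3_ge_padic_rat`) — Yu's Lemma 5.3/5.4 at `q = 3`.

WHAT THIS IS NOT: no class sums, no Liouville, no re-indexing yet; no crux moves.

References: K. Yu, Compositio Math. 74 (1990), §3 (2.93)–(2.95) (`p = 2`, `q = 3`); K. Yu, Acta Math. 211
(2013), Lemmas 5.3–5.4.
-/

noncomputable section

open Finset NormedSpace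
open Literature.NumberTheory.Transcendental
open Literature.NumberTheory.Transcendental.CW77.Setup (Tau tauNorm)

namespace Summit.ABC.StewartYu

namespace TwoSetup

variable (S : TwoSetup)

/-- `‖1 − cbrt k‖ < 2⁻¹` (the cube roots are principal units of the open ball). [folklore] -/
theorem norm_one_sub_cbrt_lt (k : Fin (S.d + 1)) : ‖1 - S.cbrt k‖ < ((2 : ℕ) : ℝ)⁻¹ := by
  rw [norm_sub_rev]
  exact (S.norm_cbrt_sub_one_le k).trans_lt (by norm_num)

/-- `log₂ cbrt_k = 3⁻¹ · log₂ all_k`. [cite: Koblitz1984, Ch. IV §2] -/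
theorem plog_cbrt (k : Fin (S.d + 1)) :
    PadicExp.plog (S.cbrt k) = ((3 : ℕ) : ℚ_[2])⁻¹ * S.lgAll k := by
  haveI : Fact (Nat.Prime 2) := ⟨Nat.prime_two⟩
  unfold cbrt
  refine PadicExp.plog_exp_of_norm_lt (ℓ := 2) ?_
  rw [norm_mul, TwoAdic.norm_inv_three_two, one_mul]
  exact (S.norm_lgAll_le k).trans_lt (by norm_num)

/-- **The exact exponential at a third point**: `exp(zψ(u,u_θ)·(s/3)) = ∏ₖ cbrt_k^{κₖ s}`, `κ = (u, u_θ)` signed.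
[cite: Yu1990, §3 (2.93)] -/
theorem exp_third_mul_zψ (u : Fin S.d → ℤ) (uθ : ℤ) (s : ℤ) :
    exp (S.zψ u uθ * ((s : ℚ_[2]) * ((3 : ℕ) : ℚ_[2])⁻¹)) =
      ∏ k : Fin (S.d + 1), S.cbrt k ^ ((Fin.snoc u uθ : Fin (S.d + 1) → ℤ) k * s) := by
  haveI : Fact (Nat.Prime 2) := ⟨Nat.prime_two⟩
  set z : Fin (S.d + 1) → ℤ := fun k => (Fin.snoc u uθ : Fin (S.d + 1) → ℤ) k * s with hz
  have e : S.zψ u uθ * ((s : ℚ_[2]) * ((3 : ℕ) : ℚ_[2])⁻¹) =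
      ∑ k : Fin (S.d + 1), (z k : ℚ_[2]) * PadicExp.plog (S.cbrt k) := by
    simp_rw [S.plog_cbrt]
    unfold zψ lg lgθ
    rw [Fin.sum_univ_castSucc]
    simp only [hz, Fin.snoc_castSucc, Fin.snoc_last]
    push_cast
    rw [add_mul, Finset.sum_mul]
    congr 1
    · exact Finset.sum_congr rfl fun j _ => by unfold lgAll ω SetupQ.all; simp only [Fin.snoc_castSucc]; ring
    · unfold lgAll ω SetupQ.all; simp only [Fin.snoc_last]; ring
  rw [e, PadicExp.exp_sum_intCast_mul_plog (ℓ := 2) univ _ _ fun k _ => S.norm_one_sub_cbrt_lt k]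

variable {ι : Type*} (R : ι → Polynomial ℚ) (u : ι → Fin S.d → ℤ) (uθ : ι → ℤ)

/-- **`φ_τ(s/3)` as a signed monomial sum in the cube roots**:
`g3Φ τ (s/3) = ∑_{i∈B} pᵢ·(Hasse_{t₀} Rᵢ)(s/3)·∏ zγⱼ(i)^{tⱼ}·∏ₖ cbrt_k^{κᵢₖ s}`. [cite: Yu1990, §3 (2.94)] -/
theorem g3Φ_third (B : Finset ι) (p : ι → ℤ) (τ : Tau S.d) (s : ℤ) :
    S.g3Φ R u uθ B p τ ((s : ℚ_[2]) * ((3 : ℕ) : ℚ_[2])⁻¹) =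
      ∑ i ∈ B, (p i : ℚ_[2]) * ((hw R i τ.1).eval ((s : ℚ_[2]) * ((3 : ℕ) : ℚ_[2])⁻¹) *
        (S.zγpow u uθ i τ.2 : ℚ_[2]) *
        ∏ k : Fin (S.d + 1), S.cbrt k ^ ((Fin.snoc (u i) (uθ i) : Fin (S.d + 1) → ℤ) k * s)) := by
  unfold g3Φ g3termΦ
  refine Finset.sum_congr rfl fun i _ => ?_
  rw [S.exp_third_mul_zψ]

/-- **Splitting a signed cube-root power by the residue mod 3**: `cbrt_k^{e} = all_k^{e / 3} · cbrt_k^{e % 3}`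
(Euclidean division, `0 ≤ e % 3 < 3`). [folklore] -/
theorem cbrt_zpow_eq (k : Fin (S.d + 1)) (e : ℤ) :
    S.cbrt k ^ e = (S.toQ.all k : ℚ_[2]) ^ (e / 3) * S.cbrt k ^ (e % 3) := by
  have h3 : S.cbrt k ^ (3 : ℤ) = (S.toQ.all k : ℚ_[2]) := by
    rw [zpow_ofNat]; exact S.cbrt_pow_three k
  have hne : S.cbrt k ≠ 0 := by
    intro h0
    have h := h3
    rw [h0, zero_zpow 3 (by norm_num)] at h
    exact (S.toQ.all_ne k) (by exact_mod_cast h.symm)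
  conv_lhs => rw [← Int.mul_ediv_add_emod e 3]
  rw [zpow_add₀ hne, zpow_mul, h3]

end TwoSetup

end Summit.ABC.StewartYu

end
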